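import Summits.Schanuel.Schanuel.Theorems.RootDecomp1DSecondExpSplit
import Summits.Schanuel.Schanuel.Theses.RootDecomp1J

/-!
# RootDecomp1D — round-5 glue: `T → Λ → K₁ → K₂ → SchanuelOverSecondExpFields` (lens-3 gen 5, NODE v6 «curve hull»)

Landed by the census seat (prover role) from the lens-3 gen-5 hand-off `v6/prover/RootDecomp1DCurveSplit.port.lean`
(`--supports stmt-Schanuel-28394`; K₁/K₂ are the decls of the SUCCESSOR route RootDecomp1J, items 29587/29588, born
06:44Z because 1D sits at the item cap).  It proves, with NO transcendence input and defining nothing: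

* `elSpan_le_curveSpan` : `𝓜 ≤ 𝓚` (the EL-span is the seed of the curve hull: level 0 of the `⨆`);
* `schanuelOverExpLogFields_of_curveSplit` : `K₁ → K₂ → D` (= item `SchanuelOverExpLogFields`, 28394) —
  ONE application of the in-tree transitivity `relOn_trans` (engine E1, `Theorems/RootDecomp1DFlagSplit.lean`)
  along `𝓜 ≤ 𝓚 ≤ ⊤`;
* `curveGlue_holds` : `T → Λ → K₁ → K₂ → P6` — the glue item of the 4-child resplit (path S″), obtained by
  feeding the previous theorem into the landed round-4 glue `schanuelOverSecondExpFieldsGlue_holds`.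

After the writer types the items, replace `Summit.Schanuel.Schanuel.Theses.RootDecomp1J.CurvePointsOverExpLogFields` / `Summit.Schanuel.Schanuel.Theses.RootDecomp1J.SchanuelOverCurveClosedFields`
by the route decls `Summit.Schanuel.Schanuel.Theses.RootDecomp1D.CurvePointsOverExpLogFields` /
`.SchanuelOverCurveClosedFields` (the texts are byte-identical, `Iff.rfl`; see `v6/children_check.lean`) and
target `Summits/Schanuel/Schanuel/Theorems/RootDecomp1DCurveSplit.lean`.
-/

set_option linter.dupNamespace false

noncomputable section

namespace Summit.Schanuel.Schanuel.Theorems.RootDecomp1DCurveSplit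

open Summit.Schanuel.Schanuel.Theses.RootDecomp1D
open Summit.Schanuel.Schanuel.Theorems.RootDecomp1DFlagSplit (relOn_trans)
open Summit.Schanuel.Schanuel.Theorems.RootDecomp1DSecondExpSplit (schanuelOverSecondExpFieldsGlue_holds)

/-- `𝓜 ≤ 𝓚`: the EL-span is level `0` of the curve hull `⨆ n, curveStep^[n+1] 𝓜` (and `𝓜 ≤ curveStep 𝓜`). -/
theorem elSpan_le_curveSpan :
    (⨆ n : ℕ, (fun E : Submodule ℚ ℂ => (E ⊔ Submodule.span ℚ (Complex.exp '' ↑E)) ⊔ Submodule.span ℚ (Complex.exp ⁻¹' ↑(E ⊔ Submodule.span ℚ (Complex.exp '' ↑E))))^[n + 1] (Submodule.span ℚ ({z : ℂ | IsAlgebraic ℚ z} ∪ {z : ℂ | ∃ β l : ℂ, IsAlgebraic ℚ β ∧ IsAlgebraic ℚ (Complex.exp l) ∧ z = β * l}))) ≤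
      ⨆ n : ℕ, (fun E : Submodule ℚ ℂ => E ⊔ Submodule.span ℚ {g : ℂ | ∃ Y : Finset ℂ, (↑Y : Set ℂ) ⊆ ↑E ∧ Algebra.trdeg ↥(IntermediateField.adjoin ℚ ((↑Y : Set ℂ) ∪ Complex.exp '' ↑Y)) ↥(IntermediateField.adjoin ↥(IntermediateField.adjoin ℚ ((↑Y : Set ℂ) ∪ Complex.exp '' ↑Y)) ({g, Complex.exp g} : Set ℂ)) ≤ 1})^[n + 1] (⨆ n : ℕ, (fun E : Submodule ℚ ℂ => (E ⊔ Submodule.span ℚ (Complex.exp '' ↑E)) ⊔ Submodule.span ℚ (Complex.exp ⁻¹' ↑(E ⊔ Submodule.span ℚ (Complex.exp '' ↑E))))^[n + 1] (Submodule.span ℚ ({z : ℂ | IsAlgebraic ℚ z} ∪ {z : ℂ | ∃ β l : ℂ, IsAlgebraic ℚ β ∧ IsAlgebraic ℚ (Complex.exp l) ∧ z = β * l}))) := by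
  refine le_trans ?_ (le_iSup_of_le 0 le_rfl)
  simp only [zero_add, Function.iterate_one]
  exact le_sup_left

/-- `K₁ → K₂ → D` (item `SchanuelOverExpLogFields`, stmt-Schanuel-28394): transitivity (E1) along `𝓜 ≤ 𝓚 ≤ ⊤`
(items over `⊤` omit the vacuous membership hypothesis). -/
theorem schanuelOverExpLogFields_of_curveSplit :
    Summit.Schanuel.Schanuel.Theses.RootDecomp1J.CurvePointsOverExpLogFields → Summit.Schanuel.Schanuel.Theses.RootDecomp1J.SchanuelOverCurveClosedFields → SchanuelOverExpLogFields := by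
  intro hK1 hK2 k m y z hy hz
  exact relOn_trans (E'' := ⊤) elSpan_le_curveSpan hK1
    (fun k m y z hy _ hz => hK2 k m y z hy hz) k m y z hy (fun _ => Submodule.mem_top) hz

/-- Glue item of the resplit (path S″): `T → Λ → K₁ → K₂ → SchanuelOverSecondExpFields` — the landed round-4
glue `T → Λ → D → P6` after `K₁ → K₂ → D`. -/
theorem curveGlue_holds :
    IteratedExpOverSecondExpFields → ExpLogOverExpTowerFields → Summit.Schanuel.Schanuel.Theses.RootDecomp1J.CurvePointsOverExpLogFields →
      Summit.Schanuel.Schanuel.Theses.RootDecomp1J.SchanuelOverCurveClosedFields → SchanuelOverSecondExpFields :=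
  fun hT hL hK1 hK2 =>
    schanuelOverSecondExpFieldsGlue_holds hT hL (schanuelOverExpLogFields_of_curveSplit hK1 hK2)

/-- The same glue with `D` kept as the middle station (for path A′ readers): `K₁ → K₂ → D` and the round-4 glue. -/
theorem schanuelOverSecondExpFields_of_TLK (hT : IteratedExpOverSecondExpFields) (hL : ExpLogOverExpTowerFields)
    (hK1 : Summit.Schanuel.Schanuel.Theses.RootDecomp1J.CurvePointsOverExpLogFields) (hK2 : Summit.Schanuel.Schanuel.Theses.RootDecomp1J.SchanuelOverCurveClosedFields) :
    SchanuelOverSecondExpFields :=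
  curveGlue_holds hT hL hK1 hK2

end Summit.Schanuel.Schanuel.Theorems.RootDecomp1DCurveSplit

end
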